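import Summits.CriticalPhenomena.PercolationContinuityZ3.Theorems.Transplant.SiteNewmanSchulmanQT
import Literature.Barriers.CriticalPhenomena.SubexponentialGrowthZdBurtonKeane
import HarnessLib

/-!
# Site Burton–Keane on amenable quasi-transitive graphs: a.s. at most one infinite SITE cluster

builds on p205010 (kernel theorem, internal audit signed; external expert review pending).

Helper file (`--supports stmt-CriticalPhenomena-4575`), lane `prim-bschramm`, site track: the
uniqueness input `U_site` of a future SITE skeleton / product node (site twin of the bond input
`BurtonKeane1989_atMostOneInfiniteCluster_holds` used by the X □ ℤ² product node), on EVERY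
connected, locally finite, quasi-transitive, amenable graph and at EVERY density:

* `sitePercolation_threeInfClusters_eq_zero_of_isGraphAmenable` — `P_p^{site}(N ≥ 3) = 0`;
* `ae_enc_numInfiniteClusters_le_one` — `N^{site} ≤ 1` a.s. (with site Newman–Schulman,
  `SiteNewmanSchulmanQT.lean`);
* `sitePercolation_ae_unique_infinite_siteCluster_of_isGraphAmenable` — in site language: a.s.
  any two sites with infinite open site clusters are joined by a path of open sites (Häggström
  2011, Thm. 2.6: "For any amenable quasi-transitive graph `G` and any `p ∈ [0, 1]`, the number of
  infinite clusters produced by i.i.d. site or bond percolation on `G` with parameter `p` is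
  either `0` or `1` a.s."; Burton–Keane 1989; Gandolfi–Keane–Newman 1992; Lyons–Peres 2016,
  Thm. 7.6 for the transitive case). The tree had the BOND statement
  (`SubexponentialGrowthZdBurtonKeane.lean`) and the SITE statement on `ℤ^d` only
  (`SiteUniquenessZd.lean`).

The proof is the bond proof of `SubexponentialGrowthZdBurtonKeane.lean` (Bollobás–Riordan 2006,
Ch. 5, Thm. 4 with graph-metric balls, the automorphism group and a Følner set; Lyons–Peres 2016,
proof of Thm. 7.6) read through hp-8's encoding `SiteZ2.enc G σ` (edges with both endpoints open;
`openGraph (enc G σ) = siteOpenGraph G σ`): every deterministic step — the exhaustion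
`threeInfClusters ⊆ ⋃_r threeInBall`, the cut-ball event `cutBallAt`, the counting lemma
`card_filter_cutBallAt_le`, the Følner geometry `card_interiorF_le_mul` /
`card_le_card_interiorF_add` / `exists_orbit_dense` — applies verbatim to `enc G σ ⊆ E(G)`; the
three measure steps are re-done for `sitePercolation V p`: transport of the cut-ball probability
along the orbit (`relabel_enc` + `sitePercolation_real_preimage_relabel`), the expected number of
cut-balls (linearity, `sum_real_preimage_cutBallAt_le`), and insertion tolerance on the SITES of
the ball (`sitePercolation_ne_zero_of_union_finset` with `isCutSet_enc_union_of_three` of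
`SiteUniqQTTools.lean` — Bollobás–Riordan's printed site move "changing the states of all the
sites in `B_r(x₀)` to open").

## References

* O. Häggström, Ann. Probab. 39 (2011) 1668–1701, Thm. 2.6 (and Def. 2.3). [Haggstrom2011]
* R. Lyons, Y. Peres, *Probability on Trees and Networks*, CUP 2016, §7.3, Thm. 7.5, Thm. 7.6
  and its proof ((7.3)–(7.5)). [LyonsPeres2016]
* B. Bollobás, O. Riordan, *Percolation*, CUP 2006, Ch. 5, Lemma 3 and Thm. 4. [BollobasRiordan2006]
* R. M. Burton, M. Keane, Comm. Math. Phys. 121 (1989) 501–505 [BurtonKeane1989]; A. Gandolfi,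
  M. S. Keane, C. M. Newman, PTRF 92 (1992) 511–527 [GandolfiKeaneNewman1992].
-/

noncomputable section

namespace Summit.CriticalPhenomena.PercolationContinuityZ3.Theorems.Transplant

namespace SiteUniqQT

open _root_.MeasureTheory _root_.ProbabilityTheory Literature.Probability.LatticeModels
  Literature.Probability.Percolation Literature.Barriers.CriticalPhenomena SiteZ2 Finset SimpleGraph
open scoped ENNReal

variable {V : Type*} {G : SimpleGraph V}

/-- At density `p = 0` there are a.s. no infinite site clusters, so in particular
`P_0^{site}(N ≥ 3) = 0`. [folklore] -/
theorem sitePercolation_threeInfClusters_eq_zero_of_coe_eq_zero [Countable V] {p : unitInterval}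
    (hp : (p : ℝ) = 0) : sitePercolation V p (enc G ⁻¹' threeInfClusters V) = 0 := by
  refine measure_mono_null ?_ (ae_iff.1 (ae_enc_eq_empty_of_coe_eq_zero (V := V) (G := G) hp))
  rintro σ ⟨x, -, -, hx, -⟩ hσ
  rw [hσ] at hx
  exact empty_notMem_percolatesAt x hx

section Three

variable [DecidableEq V] [G.LocallyFinite]

/-- **Transport of the site cut-ball probability along the orbit** (Bollobás–Riordan 2006, Ch. 5,
(2), p. 107: "for all sites `x ∈ X₀` we have `P(T_r(x)) = a`"; here along `Aut(G) x`, as the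
inequality that is used): `P^{site}_p(enc ∈ T_r(x)) ≤ P^{site}_p(enc ∈ T_r(γ x))`
(`cutBallAt_subset_preimage_relabel`, equivariance `relabel_enc`, invariance of the site product
measure under relabelling). [cite: BollobasRiordan2006, Ch. 5, proof of Thm. 4 ((2), p. 107)] -/
theorem real_preimage_cutBallAt_le_of_iso (p : unitInterval) (γ : G ≃g G) (x : V) (r : ℕ) :
    (sitePercolation V p).real (enc G ⁻¹' cutBallAt G x r) ≤
      (sitePercolation V p).real (enc G ⁻¹' cutBallAt G (γ x) r) := by
  rw [← sitePercolation_real_preimage_relabel γ.toEquiv p (enc G ⁻¹' cutBallAt G (γ x) r)]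
  refine measureReal_mono ?_
  intro σ hσ
  change enc G (SiteConfig.relabel γ.toEquiv σ) ∈ cutBallAt G (γ x) r
  rw [← relabel_enc γ σ]
  exact cutBallAt_subset_preimage_relabel γ x r hσ

open Classical in
/-- **Expected number of site cut-balls** (Bollobás–Riordan 2006, Ch. 5, p. 108: "by linearity of
expectation the expected number of cut-balls is `Σ_{w ∈ W} P(T_r(w))`"): for centres `C` in the
`(r+1)`-interior of `Λ`, `Σ_{x ∈ C} P^{site}_p(enc ∈ T_r(x)) ≤ β_{2r} |∂ⁱⁿΛ|`, integrating the
pointwise bound `card_filter_cutBallAt_le` applied to `enc G σ ⊆ E(G)`.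
[cite: BollobasRiordan2006, Ch. 5, proof of Thm. 4 (p. 108)] -/
theorem sum_real_preimage_cutBallAt_le [Countable V] (p : unitInterval) {Λ C : Finset V}
    {r β : ℕ} (hC : C ⊆ interiorF G Λ (r + 1)) (hβ : ∀ x, (ballF G x (r + r)).card ≤ β) :
    ∑ x ∈ C, (sitePercolation V p).real (enc G ⁻¹' cutBallAt G x r) ≤
      β * (innerBoundary G Λ).card := by
  set μ := sitePercolation V p with hμ
  set B : ℕ := β * (innerBoundary G Λ).card with hB
  have hmeas : ∀ x, MeasurableSet (enc G ⁻¹' cutBallAt G x r) := fun x =>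
    (measurableSet_cutBallAt x r).preimage measurable_enc
  have key : ∑ x ∈ C, μ (enc G ⁻¹' cutBallAt G x r) ≤ (B : ℝ≥0∞) := by
    have h1 : ∑ x ∈ C, μ (enc G ⁻¹' cutBallAt G x r) =
        ∫⁻ σ, ∑ x ∈ C, (enc G ⁻¹' cutBallAt G x r).indicator 1 σ ∂μ := by
      rw [lintegral_finsetSum _ fun x _ => measurable_one.indicator (hmeas x)]
      exact Finset.sum_congr rfl fun x _ => (lintegral_indicator_one (hmeas x)).symm
    rw [h1]
    calc ∫⁻ σ, ∑ x ∈ C, (enc G ⁻¹' cutBallAt G x r).indicator 1 σ ∂μ ≤ ∫⁻ _σ, (B : ℝ≥0∞) ∂μ := by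
          refine lintegral_mono fun σ => ?_
          have hsum : ∑ x ∈ C, (enc G ⁻¹' cutBallAt G x r).indicator (1 : SiteConfig V → ℝ≥0∞) σ =
              ((C.filter fun x => enc G σ ∈ cutBallAt G x r).card : ℝ≥0∞) := by
            simp only [Set.indicator_apply, Set.mem_preimage, Pi.one_apply]
            rw [Finset.sum_boole]
          rw [hsum]
          have hle : (C.filter fun x => enc G σ ∈ cutBallAt G x r).card ≤
              ((interiorF G Λ (r + 1)).filter fun x => enc G σ ∈ cutBallAt G x r).card :=
            card_le_card (filter_subset_filter _ hC)
          have h' : (((C.filter fun x => enc G σ ∈ cutBallAt G x r).card : ℕ) : ℝ≥0∞) ≤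
              ((β * (innerBoundary G Λ).card : ℕ) : ℝ≥0∞) := by
            exact_mod_cast hle.trans (card_filter_cutBallAt_le (enc_subset_edgeSet σ) hβ)
          rw [hB]
          convert h' using 3
      _ = B := by rw [lintegral_const, measure_univ, mul_one]
  have hsum : ∑ x ∈ C, μ.real (enc G ⁻¹' cutBallAt G x r) =
      (∑ x ∈ C, μ (enc G ⁻¹' cutBallAt G x r)).toReal := by
    rw [ENNReal.toReal_sum fun x _ => measure_ne_top _ _]
    rfl
  rw [hsum]
  have h := ENNReal.toReal_mono (ENNReal.natCast_ne_top B) key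
  rw [ENNReal.toReal_natCast, hB, Nat.cast_mul] at h
  exact h

/-- **`P^{site}_p(N ≥ 3) = 0` on a connected, locally finite, quasi-transitive, amenable graph**
(Burton–Keane 1989 / Gandolfi–Keane–Newman 1992 via Bollobás–Riordan 2006, Ch. 5, Thm. 4, whose
printed proof IS the site one; Lyons–Peres 2016, proof of Thm. 7.6; Häggström 2011, Thm. 2.6).
If not: `p > 0`; some `B(o, r)` meets three infinite site clusters with positive probability, so
`a = P(enc ∈ T_r(o)) > 0` by opening the SITES of the ball (`isCutSet_enc_union_of_three`,
`sitePercolation_ne_zero_of_union_finset`), and `P(enc ∈ T_r(x)) ≥ a` on the orbit of `o`; with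
a degree bound `D`, `β_k = (D+1)^k`, `R` the density radius of the orbit and
`M = β_R β_{2r}/a + β_{R+r+1}`, a Følner set `Λ` with `|∂_E Λ| ≤ |Λ|/(2M)` gives
`|Λ| ≤ M |∂ⁱⁿΛ| ≤ |Λ|/2`, absurd. [cite: LyonsPeres2016, Thm. 7.6 (proof, (7.3)–(7.5))]
[cite: Haggstrom2011, Thm. 2.6] [cite: BollobasRiordan2006, Ch. 5, Thm. 4 (pp. 107–109)] -/
theorem sitePercolation_threeInfClusters_eq_zero_of_isGraphAmenable (hconn : G.Connected)
    (hqt : IsQuasiTransitive G) (hamen : IsGraphAmenable G) (p : unitInterval) :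
    sitePercolation V p (enc G ⁻¹' threeInfClusters V) = 0 := by
  classical
  haveI : Countable V := countable_of_connected hconn
  obtain ⟨o⟩ := hconn.nonempty
  set μ := sitePercolation V p with hμ
  by_contra h3
  -- `p > 0`
  rcases eq_or_lt_of_le p.2.1 with hp0 | hp
  · exact h3 (sitePercolation_threeInfClusters_eq_zero_of_coe_eq_zero hp0.symm)
  -- some ball around `o` meets three infinite clusters with positive probability
  obtain ⟨r, hr⟩ : ∃ r, μ (enc G ⁻¹' threeInBall G o r) ≠ 0 := by
    by_contra hall
    push Not at hall
    refine h3 (measure_mono_null ?_ (measure_iUnion_null hall))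
    intro σ hσ
    have := threeInfClusters_subset_iUnion_threeInBall hconn o hσ
    simpa only [Set.preimage_iUnion, Set.mem_iUnion, Set.mem_preimage] using this
  -- opening the SITES of `B(o, r)` on this event produces a cut-ball: `a = P(enc ∈ T_r(o)) > 0`
  set K : Finset V := ballF G o r with hK
  have hAT : enc G ⁻¹' threeInBall G o r ⊆ {σ | σ ∪ (↑K : Set V) ∈ enc G ⁻¹' cutBallAt G o r} := by
    rintro σ ⟨x, hxball, hperc, hdis⟩
    exact isCutSet_enc_union_of_three hxball hperc hdis
  have hTm : MeasurableSet (enc G ⁻¹' cutBallAt G o r) :=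
    (measurableSet_cutBallAt o r).preimage measurable_enc
  have ha0 : μ (enc G ⁻¹' cutBallAt G o r) ≠ 0 :=
    sitePercolation_ne_zero_of_union_finset p hp K hTm fun h0 => hr (measure_mono_null hAT h0)
  have ha : 0 < μ.real (enc G ⁻¹' cutBallAt G o r) := by
    rw [measureReal_def, ENNReal.toReal_pos_iff]
    exact ⟨pos_iff_ne_zero.2 ha0, measure_lt_top _ _⟩
  set a := μ.real (enc G ⁻¹' cutBallAt G o r) with ha_def
  -- the constants
  obtain ⟨D, hD⟩ := hqt.exists_degree_le
  obtain ⟨R, hR⟩ := exists_orbit_dense hconn hqt o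
  set βR : ℕ := (D + 1) ^ R with hβR
  set β2 : ℕ := (D + 1) ^ (r + r) with hβ2
  set βk : ℕ := (D + 1) ^ (R + (r + 1)) with hβk
  set M : ℝ := βR * β2 / a + βk with hM
  have hMpos : 0 < M := by positivity
  -- a Følner set
  obtain ⟨Λ, hΛne, hΛ⟩ := hamen (1 / (2 * M)) (by positivity)
  have hIn : ((innerBoundary G Λ).card : ℝ) ≤ 1 / (2 * M) * Λ.card :=
    le_trans (by exact_mod_cast card_innerBoundary_le_card_edgeBoundary Λ) hΛ
  -- the orbit points in the `(r+1)`-interior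
  set C := (interiorF G Λ (r + 1)).filter fun y => ∃ γ : G ≃g G, γ o = y with hC
  -- (1) `a |C| ≤ β_{2r} |∂ⁱⁿΛ|`
  have h1 : a * C.card ≤ β2 * (innerBoundary G Λ).card := by
    calc a * C.card = ∑ _x ∈ C, a := by rw [sum_const, nsmul_eq_mul, mul_comm]
      _ ≤ ∑ x ∈ C, μ.real (enc G ⁻¹' cutBallAt G x r) := by
          refine sum_le_sum fun x hx => ?_
          obtain ⟨γ, rfl⟩ := (mem_filter.1 hx).2
          exact real_preimage_cutBallAt_le_of_iso p γ o r
      _ ≤ β2 * (innerBoundary G Λ).card :=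
          sum_real_preimage_cutBallAt_le p (filter_subset _ _) (fun x => card_ballF_le_pow hD x _)
  -- (2) `|Λ^{(R+r+1)}| ≤ β_R |C|`
  have h2 : ((interiorF G Λ (R + (r + 1))).card : ℝ) ≤ βR * C.card := by
    exact_mod_cast card_interiorF_le_mul (Λ := Λ) (r := r) hR (fun x => card_ballF_le_pow hD x R)
  -- (3) `|Λ| ≤ |Λ^{(R+r+1)}| + β_{R+r+1} |∂ⁱⁿΛ|`
  have h3' : (Λ.card : ℝ) ≤
      (interiorF G Λ (R + (r + 1))).card + βk * (innerBoundary G Λ).card := by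
    exact_mod_cast card_le_card_interiorF_add (Λ := Λ) (fun x => card_ballF_le_pow hD x _)
  -- combine: `|Λ| ≤ M |∂ⁱⁿΛ| ≤ |Λ| / 2`
  have hCle : (C.card : ℝ) ≤ β2 * (innerBoundary G Λ).card / a := by
    rw [le_div_iff₀ ha]
    linarith
  have key : (Λ.card : ℝ) ≤ M * (innerBoundary G Λ).card :=
    calc (Λ.card : ℝ) ≤ βR * C.card + βk * (innerBoundary G Λ).card := by linarith
      _ ≤ βR * (β2 * (innerBoundary G Λ).card / a) + βk * (innerBoundary G Λ).card := by
          gcongr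
      _ = M * (innerBoundary G Λ).card := by rw [hM]; ring
  have hΛpos : (0 : ℝ) < Λ.card := by exact_mod_cast hΛne.card_pos
  have hhalf : M * (1 / (2 * M) * Λ.card) = Λ.card / 2 := by
    field_simp
  have : (Λ.card : ℝ) ≤ Λ.card / 2 :=
    calc (Λ.card : ℝ) ≤ M * (innerBoundary G Λ).card := key
      _ ≤ M * (1 / (2 * M) * Λ.card) := by gcongr
      _ = Λ.card / 2 := hhalf
  linarith

/-- **Site Burton–Keane on amenable quasi-transitive graphs, count form**: for site percolation
on a connected, locally finite, quasi-transitive, amenable graph, at every `p`, almost surely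
`N^{site} = numInfiniteClusters (enc G σ) ≤ 1`. Proof: `P(N ≥ 3) = 0` gives `N ≠ ∞` a.s., and
site Newman–Schulman (`ae_enc_numInfiniteClusters_le_one_of_ae_ne_top`) gives `N ≤ 1`.
[cite: Haggstrom2011, Thm. 2.6] [cite: LyonsPeres2016, Thm. 7.6 and Thm. 7.5] -/
theorem ae_enc_numInfiniteClusters_le_one (hconn : G.Connected) (hqt : IsQuasiTransitive G)
    (hamen : IsGraphAmenable G) (p : unitInterval) :
    ∀ᵐ σ ∂(sitePercolation V p), numInfiniteClusters (enc G σ) ≤ 1 := by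
  refine ae_enc_numInfiniteClusters_le_one_of_ae_ne_top G hconn hqt p ?_
  have h0 : sitePercolation V p (enc G ⁻¹' threeInfClusters V) = 0 :=
    sitePercolation_threeInfClusters_eq_zero_of_isGraphAmenable hconn hqt hamen p
  rw [← compl_mem_ae_iff] at h0
  filter_upwards [h0] with σ hσ htop
  refine hσ ((mem_threeInfClusters_iff (enc G σ)).2 ?_)
  rw [htop]
  exact le_top

end Three

/-- **Uniqueness of the infinite cluster for Bernoulli SITE percolation on amenable
quasi-transitive graphs** (Burton–Keane 1989 / Gandolfi–Keane–Newman 1992; Häggström 2011,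
Thm. 2.6: "For any amenable quasi-transitive graph `G` and any `p ∈ [0, 1]`, the number of
infinite clusters produced by i.i.d. site or bond percolation on `G` with parameter `p` is either
`0` or `1` a.s."): on a connected, locally finite, quasi-transitive, amenable graph, for every
`p ∈ [0, 1]`, `P_p^{site}`-almost surely any two sites with infinite open site clusters are joined
by a path of open sites. The tree's bond statement is `BurtonKeane1989_atMostOneInfiniteCluster_holds`;
its site statement on `ℤ^d` is `sitePercolation_ae_unique_infinite_siteCluster`.
[cite: Haggstrom2011, Thm. 2.6] [cite: BurtonKeane1989, Theorem 2]
[cite: LyonsPeres2016, Thm. 7.6] -/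
theorem sitePercolation_ae_unique_infinite_siteCluster_of_isGraphAmenable [DecidableEq V]
    [G.LocallyFinite] (hconn : G.Connected) (hqt : IsQuasiTransitive G)
    (hamen : IsGraphAmenable G) (p : unitInterval) :
    ∀ᵐ σ ∂(sitePercolation V p), ∀ x y, (siteCluster G σ x).Infinite →
      (siteCluster G σ y).Infinite → (siteOpenGraph G σ).Reachable x y := by
  filter_upwards [ae_enc_numInfiniteClusters_le_one hconn hqt hamen p] with σ hσ x y hx hy
  rw [numInfiniteClusters_le_one_iff] at hσ
  have hx' : enc G σ ∈ percolatesAt x := by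
    rw [← Set.mem_preimage, preimage_enc_percolatesAt]; exact hx
  have hy' : enc G σ ∈ percolatesAt y := by
    rw [← Set.mem_preimage, preimage_enc_percolatesAt]; exact hy
  have h := hσ x y hx' hy'
  rwa [openGraph_enc] at h

end SiteUniqQT

end Summit.CriticalPhenomena.PercolationContinuityZ3.Theorems.Transplant

end
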